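import Literature.Probability.Percolation.LowestCrossing
import Literature.Probability.LatticeModels.StarLattice
import HarnessLib

/-!
# The unit squares generate the cycle space of the square lattice `ℤ²`

Topic `Literature/Probability/Percolation` (planar duality toolkit); PROOFS ONLY (no definition, no
named fact).  The nearest-neighbour companion of Lemma B.81 of Friedli–Velenik
(`generatesCycles_zdStar`, `StarLattice.lean`: the `★`-triangles generate the cycle space of
`ℤ^{d★}`): **every finite even set of edges of `ℤ²` is a sum modulo 2 of boundaries of unit
squares** (`generatesCycles_zdGraph_two`), i.e. the 4-cycles `squareEdges g` (`LowestCrossing.lean`)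
generate the cycle space of `zdGraph 2` in the sense of `GeneratesCycles`
(`CycleSpaceSeparators.lean`).  This is the input of Timár's boundary-connectivity lemma
(`exists_generator_crossing_both`, Friedli–Velenik App. B, Lemma B.83) for the square lattice,
whence the Whitney-type duality statements of planar percolation (the edge boundary of a finite
connected set with connected complement is a connected set of dual edges; Kesten 1982, §2.2–2.3,
Grimmett 1999, §11.2) without any appeal to the Jordan curve theorem.

Proof (folklore; cf. Timár 2013, proof of Thm. 3 for `ℤ^d`): induction on the position of the
lexicographically highest vertex `v` (largest `y`, then largest `x`) of the even set `Z`: no edge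
of `Z` leaves `v` upwards or to the right, so by parity both the edge to the left and the edge
downwards are in `Z`; adding the boundary of the unit square with upper-right corner `v` removes
them and only creates edges at lexicographically smaller vertices.  The induction is organised as a
double induction on the height of the top row of `Z` above the bottom of a bounding box and on the
number of vertices of `Z` in that row.

## References

* Á. Timár, *Boundary-connectivity via graph theory*, Proc. AMS 141 (2013) 475–480, §2 [Timar2013].
* S. Friedli, Y. Velenik, *Statistical Mechanics of Lattice Systems* (2017), App. B.15,
  Lemma B.81 [FriedliVelenik2017].
* H. Kesten, *Percolation theory for mathematicians* (1982), §2.2–2.3 [KestenPTM1982].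
-/

noncomputable section

open Finset SimpleGraph
open Literature.Combinatorics.SimpleGraph.CycleSpace

namespace Literature.Probability.Percolation

open LatticeModels

/-! ### The unit square is an even edge set of the lattice -/

/-- The four corners of a unit square are distinct. [folklore] -/
theorem square_corners_ne (g : Site 2) :
    g ≠ g + Pi.single 0 1 ∧ g ≠ g + Pi.single 1 1 ∧ g ≠ g + Pi.single 0 1 + Pi.single 1 1 ∧
      g + Pi.single 0 1 ≠ g + Pi.single 1 1 ∧ g + Pi.single 0 1 ≠ g + Pi.single 0 1 + Pi.single 1 1 ∧
        (g + Pi.single 1 1 : Site 2) ≠ g + Pi.single 0 1 + Pi.single 1 1 := by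
  refine ⟨?_, ?_, ?_, ?_, ?_, ?_⟩ <;>
  · intro h
    have h0 := congrFun h 0
    have h1 := congrFun h 1
    simp only [Pi.add_apply, single_zero_apply_zero, single_zero_apply_one, single_one_apply_zero,
      single_one_apply_one] at h0 h1
    omega

/-- `g + e₁ + e₀ = g + e₀ + e₁`. [folklore] -/
theorem add_single_one_add_single_zero (g : Site 2) :
    g + Pi.single 1 1 + Pi.single 0 1 = g + Pi.single 0 1 + Pi.single 1 1 := by
  rw [add_assoc, add_assoc, add_comm (Pi.single 1 1)]

/-- The edges of a unit square are lattice edges. [folklore] -/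
theorem squareEdges_subset_edgeSet (g : Site 2) : ∀ e ∈ squareEdges g, e ∈ (zdGraph 2).edgeSet := by
  intro e he
  simp only [squareEdges, Finset.mem_insert, Finset.mem_singleton] at he
  rcases he with rfl | rfl | rfl | rfl <;> rw [mem_edgeSet] <;> refine (zdGraph_adj_iff _ _).2 ?_
  · exact ⟨0, Or.inl rfl⟩
  · exact ⟨1, Or.inl rfl⟩
  · exact ⟨0, Or.inl rfl⟩
  · exact ⟨1, Or.inl rfl⟩

/-- Degrees in the boundary of a unit square: the sum of four indicators. [folklore] -/
theorem edgeDeg_squareEdges (g v : Site 2) :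
    edgeDeg (squareEdges g) v =
      (if v = g ∨ v = g + Pi.single 0 1 then 1 else 0) + ((if v = g ∨ v = g + Pi.single 1 1 then 1 else 0) +
        ((if v = g + Pi.single 1 1 ∨ v = g + Pi.single 1 1 + Pi.single 0 1 then 1 else 0) +
          (if v = g + Pi.single 0 1 ∨ v = g + Pi.single 0 1 + Pi.single 1 1 then 1 else 0))) := by
  classical
  obtain ⟨h1, h2, h3, h4, h5, h6⟩ := square_corners_ne g
  have h7 := add_single_one_add_single_zero g
  unfold edgeDeg
  rw [Finset.card_filter, squareEdges, Finset.sum_insert, Finset.sum_insert, Finset.sum_insert, Finset.sum_singleton]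
  · simp only [Sym2.mem_iff]
  · simp only [Finset.mem_singleton, Sym2.eq_iff, h7]
    tauto
  · simp only [Finset.mem_insert, Finset.mem_singleton, Sym2.eq_iff, h7]
    tauto
  · simp only [Finset.mem_insert, Finset.mem_singleton, Sym2.eq_iff, h7]
    tauto

/-- **The boundary of a unit square is even**: every vertex has degree `0` or `2` in it. [folklore] -/
theorem isEvenEdgeSet_squareEdges (g : Site 2) : IsEvenEdgeSet (squareEdges g) := by
  obtain ⟨h1, h2, h3, h4, h5, h6⟩ := square_corners_ne g
  have h7 := add_single_one_add_single_zero g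
  intro v
  rw [edgeDeg_squareEdges, h7]
  by_cases hv1 : v = g
  · subst hv1; simp [h1, h2, h3]
  by_cases hv2 : v = g + Pi.single 0 1
  · subst hv2; simp [h4, h5]
  by_cases hv3 : v = g + Pi.single 1 1
  · subst hv3; simp [h4.symm, h6]
  by_cases hv4 : v = g + Pi.single 0 1 + Pi.single 1 1
  · subst hv4; simp [hv1, hv2, hv3]
  · simp [hv1, hv2, hv3, hv4]

/-! ### The top row of an edge set inside a box -/

open Classical in
/-- The vertices of the edges of `Z` in the box `[a, b]` lying on the row `y = H`. [folklore] -/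
def topEnds (a b : Site 2) (Z : Finset (Sym2 (Site 2))) (H : ℤ) : Finset (Site 2) :=
  (Finset.Icc a b).filter fun x => x 1 = H ∧ ∃ e ∈ Z, x ∈ e

/-- Membership in `topEnds`. [folklore] -/
theorem mem_topEnds_iff {a b : Site 2} {Z : Finset (Sym2 (Site 2))} {H : ℤ} {x : Site 2} :
    x ∈ topEnds a b Z H ↔ x ∈ Finset.Icc a b ∧ x 1 = H ∧ ∃ e ∈ Z, x ∈ e := by
  rw [topEnds, Finset.mem_filter]

/-- The invariant of the induction: lattice edges, even, inside the box `[a, b]`. [folklore] -/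
def BoxEven (a b : Site 2) (Z : Finset (Sym2 (Site 2))) : Prop :=
  (∀ e ∈ Z, e ∈ (zdGraph 2).edgeSet) ∧ IsEvenEdgeSet Z ∧ ∀ e ∈ Z, ∀ x ∈ e, x ∈ Finset.Icc a b

/-- Coordinates of membership in the box. [folklore] -/
theorem mem_Icc_site_iff {a b x : Site 2} : x ∈ Finset.Icc a b ↔ (a 0 ≤ x 0 ∧ a 1 ≤ x 1) ∧ (x 0 ≤ b 0 ∧ x 1 ≤ b 1) := by
  simp only [Finset.mem_Icc, Pi.le_def, Fin.forall_fin_two]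

/-! ### The peeling step -/

/-- **An edge of `Z` at the lexicographically highest vertex `v` goes left or down.** [folklore] -/
theorem filter_mem_subset_of_top {a b : Site 2} {Z : Finset (Sym2 (Site 2))} (hZ : BoxEven a b Z) {H : ℤ}
    (hH : ∀ e ∈ Z, ∀ x ∈ e, x 1 ≤ H) {v : Site 2} (hv : v ∈ topEnds a b Z H)
    (hmax : ∀ w ∈ topEnds a b Z H, w 0 ≤ v 0) :
    Z.filter (v ∈ ·) ⊆ {s(v - Pi.single 0 1, v), s(v - Pi.single 1 1, v)} := by
  intro e he
  rw [Finset.mem_filter] at he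
  obtain ⟨heZ, hve⟩ := he
  have heE := hZ.1 e heZ
  obtain ⟨hvI, hv1, -⟩ := mem_topEnds_iff.1 hv
  -- write `e = {v, w}` with `w` adjacent to `v`
  obtain ⟨w, rfl⟩ : ∃ w, e = s(v, w) := Sym2.mem_iff_exists.1 hve
  have hadj : (zdGraph 2).Adj v w := heE
  rw [Finset.mem_insert, Finset.mem_singleton]
  rcases stepKind_of_adj hadj with ⟨h0, h1⟩ | ⟨h0, h1⟩ | ⟨h1, h0⟩ | ⟨h1, h0⟩
  · -- right: `w` is a higher vertex of the top row
    exfalso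
    have hwI : w ∈ Finset.Icc a b := hZ.2.2 _ heZ w (Sym2.mem_mk_right _ _)
    have hw : w ∈ topEnds a b Z H := mem_topEnds_iff.2 ⟨hwI, by omega, _, heZ, Sym2.mem_mk_right _ _⟩
    have := hmax w hw
    omega
  · left
    have : w = v - Pi.single 0 1 := by
      rw [Site.eq_iff_two]; simp only [Pi.sub_apply, single_zero_apply_zero, single_zero_apply_one]; omega
    rw [this, Sym2.eq_swap]
  · -- up: `w` is above the top row
    exfalso
    have := hH _ heZ w (Sym2.mem_mk_right _ _)
    omega
  · right
    have : w = v - Pi.single 1 1 := by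
      rw [Site.eq_iff_two]; simp only [Pi.sub_apply, single_one_apply_zero, single_one_apply_one]; omega
    rw [this, Sym2.eq_swap]

/-- **Both the edge to the left and the edge downwards at the highest vertex are in `Z`** (parity).
[folklore] -/
theorem left_down_mem_of_top {a b : Site 2} {Z : Finset (Sym2 (Site 2))} (hZ : BoxEven a b Z) {H : ℤ}
    (hH : ∀ e ∈ Z, ∀ x ∈ e, x 1 ≤ H) {v : Site 2} (hv : v ∈ topEnds a b Z H)
    (hmax : ∀ w ∈ topEnds a b Z H, w 0 ≤ v 0) :
    s(v - Pi.single 0 1, v) ∈ Z ∧ s(v - Pi.single 1 1, v) ∈ Z := by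
  classical
  have hsub := filter_mem_subset_of_top hZ hH hv hmax
  have hne : s(v - Pi.single 0 1, v) ≠ s(v - Pi.single 1 1, v) := by
    intro h
    rcases Sym2.eq_iff.1 h with ⟨h1, _⟩ | ⟨h1, _⟩
    · have := congrFun h1 0
      simp only [Pi.sub_apply, single_zero_apply_zero, single_one_apply_zero] at this
      omega
    · have := congrFun h1 0
      simp only [Pi.sub_apply, single_zero_apply_zero] at this
      omega
  -- the degree at `v` is even and positive, hence `2`, so the filter is the whole pair
  have hdeg : edgeDeg Z v = #(Z.filter (v ∈ ·)) := rfl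
  have hpos : 0 < edgeDeg Z v := by
    obtain ⟨-, -, e, he, hve⟩ := mem_topEnds_iff.1 hv
    exact Finset.card_pos.2 ⟨e, Finset.mem_filter.2 ⟨he, hve⟩⟩
  have hle : edgeDeg Z v ≤ 2 := by
    rw [hdeg]
    exact (Finset.card_le_card hsub).trans (by rw [Finset.card_pair hne])
  have heven := hZ.2.1 v
  have htwo : #(Z.filter (v ∈ ·)) = 2 := by
    rw [← hdeg]
    rcases heven with ⟨k, hk⟩
    omega
  have heq : Z.filter (v ∈ ·) = {s(v - Pi.single 0 1, v), s(v - Pi.single 1 1, v)} :=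
    Finset.eq_of_subset_of_card_le hsub (by rw [Finset.card_pair hne, htwo])
  constructor
  · have : s(v - Pi.single 0 1, v) ∈ Z.filter (v ∈ ·) := by rw [heq]; simp
    exact (Finset.mem_filter.1 this).1
  · have : s(v - Pi.single 1 1, v) ∈ Z.filter (v ∈ ·) := by rw [heq]; simp
    exact (Finset.mem_filter.1 this).1

/-- The unit square with upper-right corner `v`, written from its lower-left corner `v - (1,1)`.
[folklore] -/
theorem squareEdges_sub_one (v : Site 2) :
    squareEdges (v - Pi.single 0 1 - Pi.single 1 1) =
      {s(v - Pi.single 0 1 - Pi.single 1 1, v - Pi.single 1 1), s(v - Pi.single 0 1 - Pi.single 1 1, v - Pi.single 0 1),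
        s(v - Pi.single 0 1, v), s(v - Pi.single 1 1, v)} := by
  have e1 : v - Pi.single 0 1 - Pi.single 1 1 + Pi.single 0 1 = v - Pi.single 1 1 := by abel
  have e2 : v - Pi.single 0 1 - Pi.single 1 1 + Pi.single 1 1 = v - Pi.single 0 1 := by abel
  have e3 : v - Pi.single 0 1 - Pi.single 1 1 + Pi.single 1 1 + Pi.single 0 1 = v := by abel
  have e4 : v - Pi.single 0 1 - Pi.single 1 1 + Pi.single 0 1 + Pi.single 1 1 = v := by abel
  rw [squareEdges, e3, e4, e1, e2]

/-- **The peeling step**: adding the square below-left of the highest vertex `v` keeps the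
invariant and the height bound, and removes `v` from the top row without adding to it. [folklore] -/
theorem peel_step {a b : Site 2} {Z : Finset (Sym2 (Site 2))} (hZ : BoxEven a b Z) {H : ℤ}
    (hH : ∀ e ∈ Z, ∀ x ∈ e, x 1 ≤ H) {v : Site 2} (hv : v ∈ topEnds a b Z H)
    (hmax : ∀ w ∈ topEnds a b Z H, w 0 ≤ v 0) :
    BoxEven a b (symmDiff (squareEdges (v - Pi.single 0 1 - Pi.single 1 1)) Z) ∧
      (∀ e ∈ symmDiff (squareEdges (v - Pi.single 0 1 - Pi.single 1 1)) Z, ∀ x ∈ e, x 1 ≤ H) ∧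
        topEnds a b (symmDiff (squareEdges (v - Pi.single 0 1 - Pi.single 1 1)) Z) H ⊆ (topEnds a b Z H).erase v := by
  classical
  obtain ⟨hl, hd⟩ := left_down_mem_of_top hZ hH hv hmax
  obtain ⟨hvI, hv1, -⟩ := mem_topEnds_iff.1 hv
  have hlI : v - Pi.single 0 1 ∈ Finset.Icc a b := hZ.2.2 _ hl _ (Sym2.mem_mk_left _ _)
  have hdI : v - Pi.single 1 1 ∈ Finset.Icc a b := hZ.2.2 _ hd _ (Sym2.mem_mk_left _ _)
  rw [mem_Icc_site_iff] at hvI hlI hdI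
  simp only [Pi.sub_apply, single_zero_apply_zero, single_zero_apply_one, single_one_apply_zero,
    single_one_apply_one] at hlI hdI
  have hg0 : (v - Pi.single 0 1 - Pi.single 1 1 : Site 2) 0 = v 0 - 1 := by simp
  have hg1 : (v - Pi.single 0 1 - Pi.single 1 1 : Site 2) 1 = v 1 - 1 := by simp
  have hgI : (v - Pi.single 0 1 - Pi.single 1 1 : Site 2) ∈ Finset.Icc a b := by rw [mem_Icc_site_iff, hg0, hg1]; omega
  -- endpoints of the square are in the box and not above the top row
  have hQbox : ∀ e ∈ squareEdges (v - Pi.single 0 1 - Pi.single 1 1), ∀ x ∈ e, x ∈ Finset.Icc a b ∧ x 1 ≤ H := by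
    intro e he x hx
    rw [squareEdges_sub_one] at he
    simp only [Finset.mem_insert, Finset.mem_singleton] at he
    have hvI' : v ∈ Finset.Icc a b := by rw [mem_Icc_site_iff]; exact hvI
    have hlI' : v - Pi.single 0 1 ∈ Finset.Icc a b := hZ.2.2 _ hl _ (Sym2.mem_mk_left _ _)
    have hdI' : v - Pi.single 1 1 ∈ Finset.Icc a b := hZ.2.2 _ hd _ (Sym2.mem_mk_left _ _)
    rcases he with rfl | rfl | rfl | rfl <;> rcases Sym2.mem_iff.1 hx with rfl | rfl
    · exact ⟨hgI, by omega⟩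
    · exact ⟨hdI', by simp only [Pi.sub_apply, single_one_apply_one]; omega⟩
    · exact ⟨hgI, by omega⟩
    · exact ⟨hlI', by simp only [Pi.sub_apply, single_zero_apply_one]; omega⟩
    · exact ⟨hlI', by simp only [Pi.sub_apply, single_zero_apply_one]; omega⟩
    · exact ⟨hvI', by omega⟩
    · exact ⟨hdI', by simp only [Pi.sub_apply, single_one_apply_one]; omega⟩
    · exact ⟨hvI', by omega⟩
  refine ⟨⟨fun e he => ?_, isEvenEdgeSet_symmDiff (isEvenEdgeSet_squareEdges _) hZ.2.1, fun e he x hx => ?_⟩,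
    fun e he x hx => ?_, fun x hx => ?_⟩
  · rw [Finset.mem_symmDiff] at he
    rcases he with ⟨h, -⟩ | ⟨h, -⟩
    · exact squareEdges_subset_edgeSet _ e h
    · exact hZ.1 e h
  · rw [Finset.mem_symmDiff] at he
    rcases he with ⟨h, -⟩ | ⟨h, -⟩
    · exact (hQbox e h x hx).1
    · exact hZ.2.2 e h x hx
  · rw [Finset.mem_symmDiff] at he
    rcases he with ⟨h, -⟩ | ⟨h, -⟩
    · exact (hQbox e h x hx).2
    · exact hH e h x hx
  · -- the new top row loses `v` and gains nothing
    obtain ⟨hxI, hx1, e, he, hxe⟩ := mem_topEnds_iff.1 hx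
    rw [Finset.mem_erase]
    rw [Finset.mem_symmDiff] at he
    rcases he with ⟨heQ, heZ⟩ | ⟨heZ, heQ⟩
    · -- an edge of the square not in `Z`: one of the two lower edges; its only top-row end is `v - e₀`
      rw [squareEdges_sub_one] at heQ
      simp only [Finset.mem_insert, Finset.mem_singleton] at heQ
      rcases heQ with rfl | rfl | rfl | rfl
      · exfalso
        rcases Sym2.mem_iff.1 hxe with rfl | rfl
        · omega
        · simp only [Pi.sub_apply, single_one_apply_one] at hx1; omega
      · rcases Sym2.mem_iff.1 hxe with rfl | rfl
        · exfalso; omega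
        · refine ⟨fun h => ?_, mem_topEnds_iff.2 ⟨hxI, hx1, _, hl, Sym2.mem_mk_left _ _⟩⟩
          have := congrFun h 0
          simp only [Pi.sub_apply, single_zero_apply_zero] at this
          omega
      · exact absurd hl heZ
      · exact absurd hd heZ
    · refine ⟨fun hxv => heQ ?_, mem_topEnds_iff.2 ⟨hxI, hx1, e, heZ, hxe⟩⟩
      -- an edge of `Z` at `v` is one of the two upper edges of the square
      subst hxv
      have hmem : e ∈ Z.filter (x ∈ ·) := Finset.mem_filter.2 ⟨heZ, hxe⟩
      have := filter_mem_subset_of_top hZ hH hv hmax hmem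
      rw [squareEdges_sub_one]
      simp only [Finset.mem_insert, Finset.mem_singleton] at this ⊢
      tauto

/-! ### The induction -/

/-- **Row induction**: if every even set of lattice edges in the box lying strictly below the row
`y = H` is a sum of squares, so is every even set lying weakly below it (induction on the number of
its vertices on the row `y = H`, by peeling). [folklore] -/
theorem inSpan_squares_row {a b : Site 2} {H : ℤ}
    (hlow : ∀ Z : Finset (Sym2 (Site 2)), BoxEven a b Z → (∀ e ∈ Z, ∀ x ∈ e, x 1 ≤ H - 1) →
      InSpan (Set.range squareEdges) Z) :
    ∀ (c : ℕ) (Z : Finset (Sym2 (Site 2))), BoxEven a b Z → (∀ e ∈ Z, ∀ x ∈ e, x 1 ≤ H) →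
      #(topEnds a b Z H) ≤ c → InSpan (Set.range squareEdges) Z := by
  classical
  -- an empty top row improves the height bound
  have hempty : ∀ Z : Finset (Sym2 (Site 2)), BoxEven a b Z → (∀ e ∈ Z, ∀ x ∈ e, x 1 ≤ H) →
      topEnds a b Z H = ∅ → InSpan (Set.range squareEdges) Z := by
    intro Z hZ hH hT
    refine hlow Z hZ fun e he x hx => ?_
    have hx1 := hH e he x hx
    by_contra hlt
    have hx' : x ∈ topEnds a b Z H := mem_topEnds_iff.2 ⟨hZ.2.2 e he x hx, by omega, e, he, hx⟩
    rw [hT] at hx'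
    exact absurd hx' (Finset.notMem_empty _)
  intro c
  induction c with
  | zero =>
    intro Z hZ hH hc
    rw [Nat.le_zero, Finset.card_eq_zero] at hc
    exact hempty Z hZ hH hc
  | succ c ihc =>
    intro Z hZ hH hc
    by_cases hT : topEnds a b Z H = ∅
    · exact hempty Z hZ hH hT
    · obtain ⟨v, hv, hmax⟩ := Finset.exists_max_image _ (fun w : Site 2 => w 0) (Finset.nonempty_iff_ne_empty.2 hT)
      obtain ⟨hZ', hH', hT'⟩ := peel_step hZ hH hv hmax
      have hcard : #(topEnds a b (symmDiff (squareEdges (v - Pi.single 0 1 - Pi.single 1 1)) Z) H) ≤ c := by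
        have := Finset.card_le_card hT'
        rw [Finset.card_erase_of_mem hv] at this
        omega
      have hstep := InSpan.step (𝒞 := Set.range squareEdges) (C := squareEdges (v - Pi.single 0 1 - Pi.single 1 1))
        ⟨_, rfl⟩ (ihc _ hZ' hH' hcard)
      rwa [symmDiff_symmDiff_cancel_left] at hstep

/-- **Peeling induction**: an even set of lattice edges inside the box `[a, b]` whose top row is at
height `≤ a₁ + h` is a sum of unit squares (induction on `h`). [folklore] -/
theorem inSpan_squares_of_boxEven (a b : Site 2) :
    ∀ (h : ℕ) (Z : Finset (Sym2 (Site 2))), BoxEven a b Z → (∀ e ∈ Z, ∀ x ∈ e, x 1 ≤ a 1 + h) →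
      InSpan (Set.range squareEdges) Z := by
  classical
  intro h
  induction h with
  | zero =>
    intro Z hZ hH
    refine inSpan_squares_row (H := a 1) (fun Z' hZ' hH' => ?_) _ Z hZ (fun e he x hx => by
      have := hH e he x hx; push_cast at this; omega) le_rfl
    -- below the bottom of the box there is nothing
    have hZe : Z' = ∅ := by
      rw [Finset.eq_empty_iff_forall_notMem]
      intro e he
      induction e using Sym2.ind with
      | h x y =>
        have hxI := mem_Icc_site_iff.1 (hZ'.2.2 _ he x (Sym2.mem_mk_left _ _))
        have hx1 := hH' _ he x (Sym2.mem_mk_left _ _)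
        omega
    rw [hZe]; exact InSpan.empty
  | succ h ihh =>
    intro Z hZ hH
    refine inSpan_squares_row (H := a 1 + ↑(h + 1)) (fun Z' hZ' hH' => ihh Z' hZ' fun e he x hx => ?_) _ Z hZ hH le_rfl
    have := hH' e he x hx
    push_cast at this ⊢
    omega

/-- **The unit squares generate the cycle space of `ℤ²`**: every finite even set of edges of the
square lattice is a sum modulo 2 of boundaries of unit squares. [cite: Timar2013, §2 (proof of Theorem 3: the 4-cycles generate the cycle space of ℤ^d)] -/
theorem generatesCycles_zdGraph_two : GeneratesCycles (zdGraph 2) (Set.range squareEdges) := by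
  classical
  intro Z hZ heven
  obtain ⟨R, hR⟩ := exists_box_of_finset Z
  set a : Site 2 := fun _ => -(R : ℤ) with ha
  set b : Site 2 := fun _ => (R : ℤ) with hb
  have hbox : BoxEven a b Z := ⟨hZ, heven, fun e he x hx => by
    rw [mem_Icc_site_iff]
    have h0 := hR e he x hx 0
    have h1 := hR e he x hx 1
    exact ⟨⟨h0.1, h1.1⟩, h0.2, h1.2⟩⟩
  refine inSpan_squares_of_boxEven a b (2 * R) Z hbox fun e he x hx => ?_
  have h1 := hR e he x hx 1
  show x 1 ≤ -(R : ℤ) + ↑(2 * R)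
  push_cast; omega

/-- The squares are even lattice edge sets (the side conditions of Timár's lemma). [folklore] -/
theorem squares_isEvenEdgeSet : ∀ C ∈ Set.range squareEdges, IsEvenEdgeSet C := by
  rintro C ⟨g, rfl⟩; exact isEvenEdgeSet_squareEdges g

/-- The squares consist of lattice edges (the side conditions of Timár's lemma). [folklore] -/
theorem squares_subset_edgeSet : ∀ C ∈ Set.range squareEdges, ∀ e ∈ C, e ∈ (zdGraph 2).edgeSet := by
  rintro C ⟨g, rfl⟩; exact squareEdges_subset_edgeSet g

end Literature.Probability.Percolation

end
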